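import Summits.CriticalPhenomena.PercolationContinuityZ3.Theorems.Transplant.SkelFrmBParamsFaceFloorsHypsF
import Summits.CriticalPhenomena.PercolationContinuityZ3.Theorems.Transplant.SkelFrmBParamsFaceFloorsYxW
import Summits.CriticalPhenomena.PercolationContinuityZ3.Theorems.Transplant.SkelFrmBParamsFaceOriginsYQA
import HarnessLib

/-!
# N2 (frames-only node, OPEN) — (F) column under (R-44)(c)/(R-48)/(R-49)(c2b), DISCHARGE LAYER: **THE X4-SHAPED y′-FACE FLOORS IN THE V PROVIDER's
# PREMISE SHAPE** (hp-8 g43; the Yx twin of `KS.floorsY_YFs_FW`, SkelFrmBParamsFaceFloorsYY2HFW)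

The `floors` premise of `Skelφ.numsYx_provider₂EV` (SkelPhiFaceNumsYxP2V) reads, per kit centre with cell point `z`: y′-face (`du.1 = 1`),
ONWARD step (`du.2 = true`), the level window `faceL − E ≤ lev ≤ faceL + E`, and the contact ABOUT THE SHIFTED WINDOW CENTRE
`|z⊥ − (cenS x⊥ + P.faceSh du)| ≤ kE` — and wants `Skelφ.FloorsYx2V … P …`. `KS.floorsYx_YFs_FW` supplies it from the assembly
`KS.floorsYx2_YFsW` (YxW) at ANY dominating slot value (`gxFc ≤ gx`, `fxFc ≤ fx`: `slotsF_hyps/cellsF_hyps/bandF_facts`, HypsF), with the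
window reading turned into the start row by `KS.hTwx_of_shiftedY` (`2kE + hF₁ − hB₁ + 24u₀ + 10 ≤ 2(c₁ + bwY)` ⇒ `12u₀ + 5 ≤ T0Y + bwY` and
`|z₀ − cenS x₀| ≤ kE + r₀`); kept node rows: `hkE/hkE8/hkE24` (in `kE + r₀`), `hfwdx`, `NX0 ≤ c`, `πBudX ≤ r`; NO sign hypothesis on `v_L`.
NON-VACUITY: instantiated by the packager/BTC layers at the node tuple (slots of record dominate the residuals; rows from stmt's room/window
values). builds on p205010 (kernel theorem, internal audit signed; external expert review pending) — nothing here uses p205010; NOTHING is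
claimed about the open node `SamePDropOfSkeletonFrm₁`.
Lane `prim-bschramm`, seat `prim-hp-8` (gen 43); helper file (`--supports stmt-CriticalPhenomena-4575 --as helper`).
[cite: KozmaNitzan2024, §4 Lemma 11–12 (pp. 21–25), Theorem 6 (pp. 25–31)] [cite: MartineauTassion2017, §4.3]
-/

noncomputable section

open scoped Classical

namespace Summit.CriticalPhenomena.PercolationContinuityZ3.Theorems.Transplant

namespace PlanarSkeletonFrm

namespace NegB

namespace KS

open Literature.Probability.Percolation Literature.Probability.LatticeModels SimpleGraph
open Literature.Probability.Percolation.KozmaNitzan.Cells (oth sgOf sgOf_sign)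
open SkelConc (Consts)
open Skelφ.StepI (DataNS)
open TwoAxis.Para (modulus)
open Neg

/-- **The window row gives the Yx start row**: `2kE + hF₁ − hB₁ + 24u₀ + 10 ≤ 2(c₁ + bw)` and the contact about the shifted centre give
`12u₀ + 5 ≤ T0Y + bw` and `|z₀ − cenS x₀| ≤ kE + r₀` (`|faceSh| ≤ r₀`, `faceSh = (hF₁ − hB₁)/2` one-sided). [folklore] -/
theorem hTwx_of_shiftedY (κ : Consts) {V : Type} [DecidableEq V] [Countable V] {G : SimpleGraph V} [G.LocallyFinite] (Φ : PlanarSkeletonFrm G) (t : V) (p : unitInterval) (D : Skelφ.StepI.DataNS V) (g f : ℕ)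
    (P : PCells2V) (x : Site 2) (du : MDir) (hd : du.1 = 1) (hs : du.2 = true) (z : Site 2) {kE : ℤ} {bw : ℕ}
    (hzW : |z 0 - (P.cenS x 0 + P.faceSh du)| ≤ kE)
    (hfwd : 2 * kE + (P.hF 1 : ℤ) - P.hB 1 + 24 * u₀A κ Φ t p D g f + 10 ≤ 2 * ((P.c 1 : ℤ) + bw)) :
    12 * u₀A κ Φ t p D g f + 5 ≤ T0Y P.toPCells2T x du z + bw ∧ |z 0 - P.cenS x 0| ≤ kE + (P.r 0 : ℤ) := by
  have hsg : sgOf du = 1 := by unfold sgOf; rw [hs]; rfl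
  have hsh := P.abs_faceSh_le du
  rw [hd, show oth (1 : Fin 2) = 0 from rfl] at hsh
  obtain ⟨s1, s2⟩ := abs_le.1 hsh
  obtain ⟨w1, w2⟩ := abs_le.1 hzW
  have e : T0Y P.toPCells2T x du z = -(z 0 - P.cenS x 0) + sgOf du * (P.c 1 : ℤ) := by
    unfold T0Y; rw [cenS_step_zero P.toPCells2T x du hd]; ring
  have hfs : P.faceSh du = ((P.hF 1 : ℤ) - P.hB 1) / 2 := by unfold PCells2V.faceSh; rw [hsg, hd, one_mul]
  refine ⟨?_, abs_le.2 ⟨by linarith, by linarith⟩⟩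
  rw [e, hsg, one_mul]
  rw [hfs] at w2
  have hdiv : 2 * (((P.hF 1 : ℤ) - P.hB 1) / 2) ≤ (P.hF 1 : ℤ) - P.hB 1 := Int.mul_ediv_self_le (by norm_num)
  linarith

set_option maxHeartbeats 1600000 in
/-- **THE X4-SHAPED y′-FACE FLOORS SERVED IN THE PROVIDER's PREMISE SHAPE** (one-sided; see the module docstring). [cite: KozmaNitzan2024, §4 Lemma 12 (pp. 23–25)] -/
theorem floorsYx_YFs_FW (κ : Consts) {V : Type} [DecidableEq V] [Countable V] {G : SimpleGraph V} [G.LocallyFinite] (Φ : PlanarSkeletonFrm G) (t : V) (p : unitInterval) (D : Skelφ.StepI.DataNS V) (c mk : ℕ) (gx fx : Neg.FSlot)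
    (hgx : ∀ D : DataNS V, gxFc mk c κ Φ t p D ≤ gx κ Φ t p D) (hfx : ∀ D : DataNS V, fxFc mk κ Φ t p D ≤ fx κ Φ t p D)
    (hN : EqNumL κ Φ t p D (gT mk gx κ Φ t p D) (fT mk fx κ Φ t p D)) (hκ : (hL κ Φ t p D (gT mk gx κ Φ t p D) (fT mk fx κ Φ t p D)).natAbs ≤ 10 * nL κ Φ t p D (gT mk gx κ Φ t p D) (fT mk fx κ Φ t p D))
    (P : PCells2V) (hP : P.toPCells2 = fcellsA κ Φ t p D (gT mk gx κ Φ t p D) (fT mk fx κ Φ t p D)) {kE : ℤ}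
    (hkE : kE + (P.r 0 : ℤ) ≤ 5 * (P.r 0 : ℤ))
    (hkE8 : kE + (P.r 0 : ℤ) + 8 * u₀A κ Φ t p D (gT mk gx κ Φ t p D) (fT mk fx κ Φ t p D) + 8 + P.c 1 ≤ 5 * (P.r 0 : ℤ))
    (hkE24 : 2 * (kE + (P.r 0 : ℤ)) + 24 * u₀A κ Φ t p D (gT mk gx κ Φ t p D) (fT mk fx κ Φ t p D) + 24 + 2 * (P.c 1 : ℤ) ≤ 5 * (P.r 0 : ℤ))
    (hfwdx : 2 * kE + (P.hF 1 : ℤ) - P.hB 1 + 24 * u₀A κ Φ t p D (gT mk gx κ Φ t p D) (fT mk fx κ Φ t p D) + 10 ≤ 2 * ((P.c 1 : ℤ) + (bwY κ Φ t p D (gT mk gx κ Φ t p D) (fT mk fx κ Φ t p D))))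
    (hc : NX0 ≤ c) (r : ℕ) (hr : πBudX κ Φ t p D c mk (gT mk gx κ Φ t p D) (fT mk fx κ Φ t p D) ≤ r) :
    ∀ (x : Site 2) (du : MDir) (j : ℕ) (z : Site 2), du.1 = 1 → du.2 = true → j < P.K →
      P.faceL du.1 j - (((KS0.Rlev0 κ Φ t p D mk + KS0.reach0 t D mk) : ℕ) : ℤ) ≤ P.lev du x z → P.lev du x z ≤ P.faceL du.1 j + (((KS0.Rlev0 κ Φ t p D mk + KS0.reach0 t D mk) : ℕ) : ℤ) →
      |z (oth du.1) - (P.cenS x (oth du.1) + P.faceSh du)| ≤ kE →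
      Skelφ.FloorsYx2V (prFA κ Φ t p D (gT mk gx κ Φ t p D) (fT mk fx κ Φ t p D)) (nL κ Φ t p D (gT mk gx κ Φ t p D) (fT mk fx κ Φ t p D)) (u₀A κ Φ t p D (gT mk gx κ Φ t p D) (fT mk fx κ Φ t p D)) (u₁A κ Φ t p D (gT mk gx κ Φ t p D) (fT mk fx κ Φ t p D))
      (modulus (nL κ Φ t p D (gT mk gx κ Φ t p D) (fT mk fx κ Φ t p D)) (hL κ Φ t p D (gT mk gx κ Φ t p D) (fT mk fx κ Φ t p D)) (vL κ Φ t p D (gT mk gx κ Φ t p D) (fT mk fx κ Φ t p D)) (vβL κ Φ t p D (gT mk gx κ Φ t p D) (fT mk fx κ Φ t p D))) (nL κ Φ t p D (gT mk gx κ Φ t p D) (fT mk fx κ Φ t p D) : ℤ) (ℓL κ Φ t p D (gT mk gx κ Φ t p D) (fT mk fx κ Φ t p D))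
      P (NegB.BSlot.small3 κ Φ t p D (gT mk gx κ Φ t p D) (fT mk fx κ Φ t p D)) x du j 3 r (Mu D) z
      (fun i => if i = 0 then kF₀A κ Φ t p D c mk (gT mk gx κ Φ t p D) (fT mk fx κ Φ t p D) else kF₁A κ Φ t p D c mk (gT mk gx κ Φ t p D) (fT mk fx κ Φ t p D))
      (BFs κ Φ t p D c mk (gT mk gx κ Φ t p D) (fT mk fx κ Φ t p D) (sgOf du)) (KS0.R'0 κ Φ t p D mk) (qBXFs κ Φ t p D mk) (KS0.R'0 κ Φ t p D mk) (qB3XA κ Φ t p D (gT mk gx κ Φ t p D) (fT mk fx κ Φ t p D) (KS0.R'0 κ Φ t p D mk))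
      (yLXFs κ Φ t p D c mk (gT mk gx κ Φ t p D) (fT mk fx κ Φ t p D) (sgOf du)) (NxW κ Φ t p D (gT mk gx κ Φ t p D) (fT mk fx κ Φ t p D) P.toPCells2T (yLXFs κ Φ t p D c mk (gT mk gx κ Φ t p D) (fT mk fx κ Φ t p D) (sgOf du)) x du z (bwY κ Φ t p D (gT mk gx κ Φ t p D) (fT mk fx κ Φ t p D))) (NrY κ Φ t p D (gT mk gx κ Φ t p D) (fT mk fx κ Φ t p D) P.toPCells2T (yTYx κ Φ t p D (gT mk gx κ Φ t p D) (fT mk fx κ Φ t p D) P.toPCells2T (yLXFs κ Φ t p D c mk (gT mk gx κ Φ t p D) (fT mk fx κ Φ t p D) (sgOf du)) x du z (bwY κ Φ t p D (gT mk gx κ Φ t p D) (fT mk fx κ Φ t p D))) x du z) := by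
  intro x du j z hd hs hj hlev1 hlev2 hzW
  obtain ⟨hnA, hnA24, hℓA, hS, hS64, hMR0, -, hRn0⟩ := slotsF_hyps κ Φ t p D c mk gx fx hgx hfx hN
  obtain ⟨hs0, hs1, -, hkF0, hkF1⟩ := cellsF_hyps κ Φ t p D c mk gx fx hgx hN hκ
  obtain ⟨hE2, -, -, hEu1⟩ := bandF_facts κ Φ t p D c mk gx fx hgx hN hκ
  have hsg : sgOf du = 1 := by unfold sgOf; rw [hs]; rfl
  rw [hd, show oth (1 : Fin 2) = 0 from rfl] at hzW
  have hd' : du.1 = 1 := hd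
  obtain ⟨hTwx, hz'⟩ := hTwx_of_shiftedY κ Φ t p D (gT mk gx κ Φ t p D) (fT mk fx κ Φ t p D) P x du hd' hs z hzW hfwdx
  have hlev1' : P.faceL 1 j - (((KS0.Rlev0 κ Φ t p D mk + KS0.reach0 t D mk) : ℕ) : ℤ) ≤ P.lev du x z := by rw [hd] at hlev1; exact hlev1
  have hlev2' : P.lev du x z ≤ P.faceL 1 j + (((KS0.Rlev0 κ Φ t p D mk + KS0.reach0 t D mk) : ℕ) : ℤ) := by rw [hd] at hlev2; exact hlev2
  exact floorsYx2_YFsW κ Φ t p D c mk gx fx P hP hN hκ hnA hnA24 hℓA hS hS64 hMR0 hRn0 hs0 hs1 hkF0 hkF1 hc x du hd' hsg j hj z hlev1' hlev2' hz'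
    (by have h' := hEu1; push_cast at h' ⊢; linarith) hE2 hkE hkE8 hkE24 hTwx r hr


end KS

end NegB

end PlanarSkeletonFrm

end Summit.CriticalPhenomena.PercolationContinuityZ3.Theorems.Transplant

end


/-!
# N2 (frames-only node, OPEN) — (F) column, (R-49)(c2b) DISCHARGE LAYER: **THE X4-SHAPED y′-FACE FLOOR PACKAGE WITH CAPPED WITNESSES** (hp-8 g43;
# the Yx twin of `KS.floorsY_pkgFW / capY_pkgFW`, SkelFrmBParamsFaceFloorsPkgFW)

The keystone's numbers binder `numsYx` is fed by `Skelφ.numsYx_provider₂EV` with CHOICE FUNCTIONS for the counts; its stride-count row `hnFyx`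
needs `0 + 1 + NrF + 1 + N3F ≤ nF` for EVERY input, so the counts are served CAPPED: `NrF := min (NxW …) (240·Kq + 9)`, `N3F := min (NrY … (yTYx …) …)
(600·Kq − 1)` — equal to the true counts wherever the floors are read (`KS.rangesYx_YFsW`: `NxW + 1 ≤ 240·Kq + 10`, `NrY(junction) + 1 ≤ 600·Kq`
under the glue's hypotheses), and within any budget `nF ≥ 840·Kq + 10` (`KS.capYx_pkgFW`). `KS.floorsYx_pkgFW` = `KS.floorsYx_YFs_FW` with
the capped witnesses.
NON-VACUITY: instantiated by the BTC layers at the node tuple. builds on p205010 (kernel theorem, internal audit signed; external expert review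
pending) — nothing here uses p205010; NOTHING is claimed about the open node `SamePDropOfSkeletonFrm₁`.
Lane `prim-bschramm`, seat `prim-hp-8` (gen 43); helper file (`--supports stmt-CriticalPhenomena-4575 --as helper`).
[cite: KozmaNitzan2024, §4 Lemma 11–12 (pp. 21–25), Theorem 6 (pp. 25–31)] [cite: MartineauTassion2017, §4.3]
-/

noncomputable section

open scoped Classical

namespace Summit.CriticalPhenomena.PercolationContinuityZ3.Theorems.Transplant

namespace PlanarSkeletonFrm

namespace NegB

namespace KS

open Literature.Probability.Percolation Literature.Probability.LatticeModels SimpleGraph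
open Literature.Probability.Percolation.KozmaNitzan.Cells (oth sgOf sgOf_sign)
open SkelConc (Consts)
open Skelφ.StepI (DataNS)
open TwoAxis.Para (modulus)
open Neg


set_option maxHeartbeats 1600000 in
/-- **The X4-shaped counts' ranges under the glue's hypotheses**: `NxW + 1 ≤ 240·Kq + 10` and `NrY(junction) + 1 ≤ 600·Kq`. [folklore] -/
theorem rangesYx_YFsW (κ : Consts) {V : Type} [DecidableEq V] [Countable V] {G : SimpleGraph V} [G.LocallyFinite] (Φ : PlanarSkeletonFrm G) (t : V) (p : unitInterval) (D : Skelφ.StepI.DataNS V) (c mk : ℕ) (gx fx : Neg.FSlot)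
    (hgx : ∀ D : DataNS V, gxFc mk c κ Φ t p D ≤ gx κ Φ t p D) (hfx : ∀ D : DataNS V, fxFc mk κ Φ t p D ≤ fx κ Φ t p D)
    (hN : EqNumL κ Φ t p D (gT mk gx κ Φ t p D) (fT mk fx κ Φ t p D)) (hκ : (hL κ Φ t p D (gT mk gx κ Φ t p D) (fT mk fx κ Φ t p D)).natAbs ≤ 10 * nL κ Φ t p D (gT mk gx κ Φ t p D) (fT mk fx κ Φ t p D))
    (P : PCells2V) (hP : P.toPCells2 = fcellsA κ Φ t p D (gT mk gx κ Φ t p D) (fT mk fx κ Φ t p D)) {kE : ℤ}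
    (hkE : kE + (P.r 0 : ℤ) ≤ 5 * (P.r 0 : ℤ))
    (hfwdx : 2 * kE + (P.hF 1 : ℤ) - P.hB 1 + 24 * u₀A κ Φ t p D (gT mk gx κ Φ t p D) (fT mk fx κ Φ t p D) + 10 ≤ 2 * ((P.c 1 : ℤ) + (bwY κ Φ t p D (gT mk gx κ Φ t p D) (fT mk fx κ Φ t p D))))
 :
    ∀ (x : Site 2) (du : MDir) (j : ℕ) (z : Site 2), du.1 = 1 → du.2 = true → j < P.K →
      P.faceL du.1 j - (((KS0.Rlev0 κ Φ t p D mk + KS0.reach0 t D mk) : ℕ) : ℤ) ≤ P.lev du x z → P.lev du x z ≤ P.faceL du.1 j + (((KS0.Rlev0 κ Φ t p D mk + KS0.reach0 t D mk) : ℕ) : ℤ) →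
      |z (oth du.1) - (P.cenS x (oth du.1) + P.faceSh du)| ≤ kE →
      (NxW κ Φ t p D (gT mk gx κ Φ t p D) (fT mk fx κ Φ t p D) P.toPCells2T (yLXFs κ Φ t p D c mk (gT mk gx κ Φ t p D) (fT mk fx κ Φ t p D) (sgOf du)) x du z (bwY κ Φ t p D (gT mk gx κ Φ t p D) (fT mk fx κ Φ t p D))) + 1 ≤ 240 * Neg.Kq κ + 10 ∧ (NrY κ Φ t p D (gT mk gx κ Φ t p D) (fT mk fx κ Φ t p D) P.toPCells2T (yTYx κ Φ t p D (gT mk gx κ Φ t p D) (fT mk fx κ Φ t p D) P.toPCells2T (yLXFs κ Φ t p D c mk (gT mk gx κ Φ t p D) (fT mk fx κ Φ t p D) (sgOf du)) x du z (bwY κ Φ t p D (gT mk gx κ Φ t p D) (fT mk fx κ Φ t p D))) x du z) + 1 ≤ 600 * Neg.Kq κ := by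
  intro x du j z hd hs hj hlev1 hlev2 hzW
  obtain ⟨-, -, -, hS, -, hMR0, -, -⟩ := slotsF_hyps κ Φ t p D c mk gx fx hgx hfx hN
  obtain ⟨-, -, -, hEu1⟩ := bandF_facts κ Φ t p D c mk gx fx hgx hN hκ
  have hσ : sgOf du = 1 ∨ sgOf du = -1 := sgOf_sign du
  rw [hd, show oth (1 : Fin 2) = 0 from rfl] at hzW
  have hd' : du.1 = 1 := hd
  have hP' : P.toPCells2T.toPCells2 = fcellsA κ Φ t p D (gT mk gx κ Φ t p D) (fT mk fx κ Φ t p D) := hP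
  obtain ⟨hTwx, hz'⟩ := hTwx_of_shiftedY κ Φ t p D (gT mk gx κ Φ t p D) (fT mk fx κ Φ t p D) P x du hd' hs z hzW hfwdx
  have hlev1' : P.faceL 1 j - (((KS0.Rlev0 κ Φ t p D mk + KS0.reach0 t D mk) : ℕ) : ℤ) ≤ P.lev du x z := by rw [hd] at hlev1; exact hlev1
  have hlev2' : P.lev du x z ≤ P.faceL 1 j + (((KS0.Rlev0 κ Φ t p D mk + KS0.reach0 t D mk) : ℕ) : ℤ) := by rw [hd] at hlev2; exact hlev2
  have hu0 : 1 ≤ u₀A κ Φ t p D (gT mk gx κ Φ t p D) (fT mk fx κ Φ t p D) := (units_eqA κ Φ t p D (gT mk gx κ Φ t p D) (fT mk fx κ Φ t p D)).2.2.2.2.1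
  have hu1 : 1 ≤ u₁A κ Φ t p D (gT mk gx κ Φ t p D) (fT mk fx κ Φ t p D) := (units_eqA κ Φ t p D (gT mk gx κ Φ t p D) (fT mk fx κ Φ t p D)).2.2.2.2.2
  obtain ⟨hΛ₀, hΛ₁⟩ := Λ_yLXFs κ Φ t p D c mk (fT mk fx κ Φ t p D) gx hN hκ hS hMR0 hσ
  have he0' : |FcA κ Φ t p D (gT mk gx κ Φ t p D) (fT mk fx κ Φ t p D) (yLXFs κ Φ t p D c mk (gT mk gx κ Φ t p D) (fT mk fx κ Φ t p D) (sgOf du))| ≤ 3 * u₀A κ Φ t p D (gT mk gx κ Φ t p D) (fT mk fx κ Φ t p D) := abs_FcA_le_of_Λ₀ κ Φ t p D (gT mk gx κ Φ t p D) (fT mk fx κ Φ t p D) hN (yLXFs κ Φ t p D c mk (gT mk gx κ Φ t p D) (fT mk fx κ Φ t p D) (sgOf du)) hΛ₀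
  have he1 : |F1cA κ Φ t p D (gT mk gx κ Φ t p D) (fT mk fx κ Φ t p D) (yLXFs κ Φ t p D c mk (gT mk gx κ Φ t p D) (fT mk fx κ Φ t p D) (sgOf du))| ≤ 2 * u₁A κ Φ t p D (gT mk gx κ Φ t p D) (fT mk fx κ Φ t p D) := abs_F1cA_le_of_Λ₁ κ Φ t p D (gT mk gx κ Φ t p D) (fT mk fx κ Φ t p D) hN (yLXFs κ Φ t p D c mk (gT mk gx κ Φ t p D) (fT mk fx κ Φ t p D) (sgOf du)) hΛ₁
  have hdx := FcA_yTX0_sub_abs_le κ Φ t p D (gT mk gx κ Φ t p D) (fT mk fx κ Φ t p D) hN (yLXFs κ Φ t p D c mk (gT mk gx κ Φ t p D) (fT mk fx κ Φ t p D) (sgOf du)) hσ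
  have hC0 : |FcA κ Φ t p D (gT mk gx κ Φ t p D) (fT mk fx κ Φ t p D) (yTX0 κ Φ t p D (gT mk gx κ Φ t p D) (fT mk fx κ Φ t p D) (yLXFs κ Φ t p D c mk (gT mk gx κ Φ t p D) (fT mk fx κ Φ t p D) (sgOf du)) (sgOf du))| ≤ 6 * u₀A κ Φ t p D (gT mk gx κ Φ t p D) (fT mk fx κ Φ t p D) + 2 := by
    have := abs_sub_abs_le_abs_sub (FcA κ Φ t p D (gT mk gx κ Φ t p D) (fT mk fx κ Φ t p D) (yTX0 κ Φ t p D (gT mk gx κ Φ t p D) (fT mk fx κ Φ t p D) (yLXFs κ Φ t p D c mk (gT mk gx κ Φ t p D) (fT mk fx κ Φ t p D) (sgOf du)) (sgOf du))) (FcA κ Φ t p D (gT mk gx κ Φ t p D) (fT mk fx κ Φ t p D) (yLXFs κ Φ t p D c mk (gT mk gx κ Φ t p D) (fT mk fx κ Φ t p D) (sgOf du))); linarith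
  have hbw2 := (bwY_eq κ Φ t p D (gT mk gx κ Φ t p D) (fT mk fx κ Φ t p D)).2
  have hF : FcA κ Φ t p D (gT mk gx κ Φ t p D) (fT mk fx κ Φ t p D) (yTX0 κ Φ t p D (gT mk gx κ Φ t p D) (fT mk fx κ Φ t p D) (yLXFs κ Φ t p D c mk (gT mk gx κ Φ t p D) (fT mk fx κ Φ t p D) (sgOf du)) (sgOf du)) + u₀A κ Φ t p D (gT mk gx κ Φ t p D) (fT mk fx κ Φ t p D) ≤ T0Y P.toPCells2T x du z + ((bwY κ Φ t p D (gT mk gx κ Φ t p D) (fT mk fx κ Φ t p D)) : ℤ) := by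
    have := (abs_le.1 hC0).2; linarith
  have hkE' : kE + (P.r 0 : ℤ) ≤ 5 * (P.toPCells2T.r 0 : ℤ) := hkE
  have hNx := NxW_range κ Φ t p D (gT mk gx κ Φ t p D) (fT mk fx κ Φ t p D) P.toPCells2T hP' (yLXFs κ Φ t p D c mk (gT mk gx κ Φ t p D) (fT mk fx κ Φ t p D) (sgOf du)) x du hd' z hz' hkE' hC0 (by linarith) hbw2 hF
  have he1T := (juncYx_F1cA κ Φ t p D (gT mk gx κ Φ t p D) (fT mk fx κ Φ t p D) hN P.toPCells2T (yLXFs κ Φ t p D c mk (gT mk gx κ Φ t p D) (fT mk fx κ Φ t p D) (sgOf du)) x du z (bwY κ Φ t p D (gT mk gx κ Φ t p D) (fT mk fx κ Φ t p D)) he1).2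
  have hEu' : ((((KS0.Rlev0 κ Φ t p D mk + KS0.reach0 t D mk) : ℕ) : ℤ)) + (2 * u₁A κ Φ t p D (gT mk gx κ Φ t p D) (fT mk fx κ Φ t p D) + 2) ≤ 8 * u₁A κ Φ t p D (gT mk gx κ Φ t p D) (fT mk fx κ Φ t p D) := by
    have h' := hEu1; push_cast at h' ⊢; linarith
  obtain ⟨-, hNy⟩ := NrY_range κ Φ t p D (gT mk gx κ Φ t p D) (fT mk fx κ Φ t p D) P.toPCells2T hP' x du hd' z hj hlev1' hlev2' (yTYx κ Φ t p D (gT mk gx κ Φ t p D) (fT mk fx κ Φ t p D) P.toPCells2T (yLXFs κ Φ t p D c mk (gT mk gx κ Φ t p D) (fT mk fx κ Φ t p D) (sgOf du)) x du z (bwY κ Φ t p D (gT mk gx κ Φ t p D) (fT mk fx κ Φ t p D))) he1T hEu'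
  exact ⟨hNx, hNy⟩

set_option maxHeartbeats 1600000 in
/-- **THE X4-SHAPED y′-FACE FLOOR PACKAGE WITH CAPPED WITNESSES** (`NrF := min (NxW …) (240·Kq + 9)`, `N3F := min (NrY … (junction) …) (600·Kq − 1)`).
[cite: KozmaNitzan2024, §4 Lemma 11–12 (pp. 21–25)] -/
theorem floorsYx_pkgFW (κ : Consts) {V : Type} [DecidableEq V] [Countable V] {G : SimpleGraph V} [G.LocallyFinite] (Φ : PlanarSkeletonFrm G) (t : V) (p : unitInterval) (D : Skelφ.StepI.DataNS V) (c mk : ℕ) (gx fx : Neg.FSlot)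
    (hgx : ∀ D : DataNS V, gxFc mk c κ Φ t p D ≤ gx κ Φ t p D) (hfx : ∀ D : DataNS V, fxFc mk κ Φ t p D ≤ fx κ Φ t p D)
    (hN : EqNumL κ Φ t p D (gT mk gx κ Φ t p D) (fT mk fx κ Φ t p D)) (hκ : (hL κ Φ t p D (gT mk gx κ Φ t p D) (fT mk fx κ Φ t p D)).natAbs ≤ 10 * nL κ Φ t p D (gT mk gx κ Φ t p D) (fT mk fx κ Φ t p D))
    (P : PCells2V) (hP : P.toPCells2 = fcellsA κ Φ t p D (gT mk gx κ Φ t p D) (fT mk fx κ Φ t p D)) {kE : ℤ}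
    (hkE : kE + (P.r 0 : ℤ) ≤ 5 * (P.r 0 : ℤ))
    (hkE8 : kE + (P.r 0 : ℤ) + 8 * u₀A κ Φ t p D (gT mk gx κ Φ t p D) (fT mk fx κ Φ t p D) + 8 + P.c 1 ≤ 5 * (P.r 0 : ℤ))
    (hkE24 : 2 * (kE + (P.r 0 : ℤ)) + 24 * u₀A κ Φ t p D (gT mk gx κ Φ t p D) (fT mk fx κ Φ t p D) + 24 + 2 * (P.c 1 : ℤ) ≤ 5 * (P.r 0 : ℤ))
    (hfwdx : 2 * kE + (P.hF 1 : ℤ) - P.hB 1 + 24 * u₀A κ Φ t p D (gT mk gx κ Φ t p D) (fT mk fx κ Φ t p D) + 10 ≤ 2 * ((P.c 1 : ℤ) + (bwY κ Φ t p D (gT mk gx κ Φ t p D) (fT mk fx κ Φ t p D))))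
    (hc : NX0 ≤ c) (r : ℕ) (hr : πBudX κ Φ t p D c mk (gT mk gx κ Φ t p D) (fT mk fx κ Φ t p D) ≤ r) :
    ∀ (x : Site 2) (du : MDir) (j : ℕ) (z : Site 2), du.1 = 1 → du.2 = true → j < P.K →
      P.faceL du.1 j - (((KS0.Rlev0 κ Φ t p D mk + KS0.reach0 t D mk) : ℕ) : ℤ) ≤ P.lev du x z → P.lev du x z ≤ P.faceL du.1 j + (((KS0.Rlev0 κ Φ t p D mk + KS0.reach0 t D mk) : ℕ) : ℤ) →
      |z (oth du.1) - (P.cenS x (oth du.1) + P.faceSh du)| ≤ kE →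
      Skelφ.FloorsYx2V (prFA κ Φ t p D (gT mk gx κ Φ t p D) (fT mk fx κ Φ t p D)) (nL κ Φ t p D (gT mk gx κ Φ t p D) (fT mk fx κ Φ t p D)) (u₀A κ Φ t p D (gT mk gx κ Φ t p D) (fT mk fx κ Φ t p D)) (u₁A κ Φ t p D (gT mk gx κ Φ t p D) (fT mk fx κ Φ t p D))
      (modulus (nL κ Φ t p D (gT mk gx κ Φ t p D) (fT mk fx κ Φ t p D)) (hL κ Φ t p D (gT mk gx κ Φ t p D) (fT mk fx κ Φ t p D)) (vL κ Φ t p D (gT mk gx κ Φ t p D) (fT mk fx κ Φ t p D)) (vβL κ Φ t p D (gT mk gx κ Φ t p D) (fT mk fx κ Φ t p D))) (nL κ Φ t p D (gT mk gx κ Φ t p D) (fT mk fx κ Φ t p D) : ℤ) (ℓL κ Φ t p D (gT mk gx κ Φ t p D) (fT mk fx κ Φ t p D))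
      P (NegB.BSlot.small3 κ Φ t p D (gT mk gx κ Φ t p D) (fT mk fx κ Φ t p D)) x du j 3 r (Mu D) z
      (fun i => if i = 0 then kF₀A κ Φ t p D c mk (gT mk gx κ Φ t p D) (fT mk fx κ Φ t p D) else kF₁A κ Φ t p D c mk (gT mk gx κ Φ t p D) (fT mk fx κ Φ t p D))
      (BFs κ Φ t p D c mk (gT mk gx κ Φ t p D) (fT mk fx κ Φ t p D) (sgOf du)) (KS0.R'0 κ Φ t p D mk) (qBXFs κ Φ t p D mk) (KS0.R'0 κ Φ t p D mk) (qB3XA κ Φ t p D (gT mk gx κ Φ t p D) (fT mk fx κ Φ t p D) (KS0.R'0 κ Φ t p D mk))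
      (yLXFs κ Φ t p D c mk (gT mk gx κ Φ t p D) (fT mk fx κ Φ t p D) (sgOf du)) (min (NxW κ Φ t p D (gT mk gx κ Φ t p D) (fT mk fx κ Φ t p D) P.toPCells2T (yLXFs κ Φ t p D c mk (gT mk gx κ Φ t p D) (fT mk fx κ Φ t p D) (sgOf du)) x du z (bwY κ Φ t p D (gT mk gx κ Φ t p D) (fT mk fx κ Φ t p D))) (240 * Neg.Kq κ + 9)) (min (NrY κ Φ t p D (gT mk gx κ Φ t p D) (fT mk fx κ Φ t p D) P.toPCells2T (yTYx κ Φ t p D (gT mk gx κ Φ t p D) (fT mk fx κ Φ t p D) P.toPCells2T (yLXFs κ Φ t p D c mk (gT mk gx κ Φ t p D) (fT mk fx κ Φ t p D) (sgOf du)) x du z (bwY κ Φ t p D (gT mk gx κ Φ t p D) (fT mk fx κ Φ t p D))) x du z) (600 * Neg.Kq κ - 1)) := by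
  intro x du j z hd hs hj hlev1 hlev2 hzW
  obtain ⟨hNx, hNy⟩ := rangesYx_YFsW κ Φ t p D c mk gx fx hgx hfx hN hκ P hP hkE hfwdx x du j z hd hs hj hlev1 hlev2 hzW
  rw [Nat.min_eq_left (Nat.lt_succ_iff.mp (Nat.lt_of_succ_le hNx)), Nat.min_eq_left (Nat.le_sub_one_of_lt (Nat.lt_of_succ_le hNy))]
  exact floorsYx_YFs_FW κ Φ t p D c mk gx fx hgx hfx hN hκ P hP hkE hkE8 hkE24 hfwdx hc r hr x du j z hd hs hj hlev1 hlev2 hzW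

/-- **The X4-shaped witnesses' stride budget** `0 + 1 + NrF + 1 + N3F ≤ nB` for any `nB ≥ 840·Kq + 10`. [folklore] -/
theorem capYx_pkgFW (κ : Consts) {V : Type} [DecidableEq V] [Countable V] {G : SimpleGraph V} [G.LocallyFinite] (Φ : PlanarSkeletonFrm G) (t : V) (p : unitInterval) (D : Skelφ.StepI.DataNS V) (c mk : ℕ) (gx fx : Neg.FSlot) (P : PCells2V) {nB : ℕ} (hnB : 840 * Neg.Kq κ + 10 ≤ nB)
    (x : Site 2) (du : MDir) (z : Site 2) :
    0 + 1 + (min (NxW κ Φ t p D (gT mk gx κ Φ t p D) (fT mk fx κ Φ t p D) P.toPCells2T (yLXFs κ Φ t p D c mk (gT mk gx κ Φ t p D) (fT mk fx κ Φ t p D) (sgOf du)) x du z (bwY κ Φ t p D (gT mk gx κ Φ t p D) (fT mk fx κ Φ t p D))) (240 * Neg.Kq κ + 9)) + 1 + (min (NrY κ Φ t p D (gT mk gx κ Φ t p D) (fT mk fx κ Φ t p D) P.toPCells2T (yTYx κ Φ t p D (gT mk gx κ Φ t p D) (fT mk fx κ Φ t p D) P.toPCells2T (yLXFs κ Φ t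 p D c mk (gT mk gx κ Φ t p D) (fT mk fx κ Φ t p D) (sgOf du)) x du z (bwY κ Φ t p D (gT mk gx κ Φ t p D) (fT mk fx κ Φ t p D))) x du z) (600 * Neg.Kq κ - 1)) ≤ nB := by
  have h1 := Nat.min_le_right (NxW κ Φ t p D (gT mk gx κ Φ t p D) (fT mk fx κ Φ t p D) P.toPCells2T (yLXFs κ Φ t p D c mk (gT mk gx κ Φ t p D) (fT mk fx κ Φ t p D) (sgOf du)) x du z (bwY κ Φ t p D (gT mk gx κ Φ t p D) (fT mk fx κ Φ t p D))) (240 * Neg.Kq κ + 9)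
  have h2 := Nat.min_le_right (NrY κ Φ t p D (gT mk gx κ Φ t p D) (fT mk fx κ Φ t p D) P.toPCells2T (yTYx κ Φ t p D (gT mk gx κ Φ t p D) (fT mk fx κ Φ t p D) P.toPCells2T (yLXFs κ Φ t p D c mk (gT mk gx κ Φ t p D) (fT mk fx κ Φ t p D) (sgOf du)) x du z (bwY κ Φ t p D (gT mk gx κ Φ t p D) (fT mk fx κ Φ t p D))) x du z) (600 * Neg.Kq κ - 1)
  have hq := Neg.one_le_Kq κ
  omega


end KS

end NegB

end PlanarSkeletonFrm

end Summit.CriticalPhenomena.PercolationContinuityZ3.Theorems.Transplant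

end
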